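import Summits.ResolutionOfSingularities.ResolutionOfSingularities.Theorems.PurelyInseparableDim4ResConeLossyTiltFreePeel
import HarnessLib
import HarnessLib.Audit.Tags

/-!
# Purely inseparable four-folds — LEGALITY TRANSPORT AT A LOSE-BOTH STEP (p = 5, d = 4): the degree-8 rows of
# the parent vanish and the degree-9 row is a FROBENIUS ROW
# (K2(p) lane, SLICE C, tilt-free D∞ brick, FILE 1b: (D1) of the plan of record; file-holder res-dim4-p-5 g4)

[OURS · counted 0 · cell `res-dim4-pi` · K2(p) lane, slice C (desk WORDS #128 (h), #130 (b)) · seat p-5 g4.]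
Nothing here proves K2(p), `NoIsolatedTrap p p` or resolution of singularities in dimension ≥ 4 / char. `p`.

THREE POLYNOMIALS `F, F₁, F₂` over a field (of characteristic `5` where the Frobenius row enters), letters `a ≠ a′`
(the only chart / boundary / translated letters; idea-4's `u₁, u₂`), the two other letters inert (idea-4's Hasse
contact letters `h₁, h₂`), boundary `r = α e_a + β e_{a′}` with `α + β = 3` (`o = 7`).  The STEPS enter only as
coefficient laws OFF the `5`-th-power lattice («noise := anything on `IsPthPowerExponent 5`»):
`hS1` = pure-shear step `a` at `t·e_{a′}` from `F` to `F₁`, `hS2` = pure corner `a′` from `F₁` to `F₂`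
(`…LayerBirths.coeff_step_F_chartExponent` furnishes both for the tree's `CentreBlowup.step`), with
`ord F₁ ≥ 6` and the TILT-FREE LOWER WINDOW at `F₂` (`ord ≥ 7`, degree-`7` monomials have `x_a`-exponent `2`).
* **`coeff_shear_eq_zero_of_legality`** — idea-4 E2 §D «`σ″ > 1` ⇔ realised `j ≥ 4n − 2D + 1`», read on the sheared
  parent: `coeff_e (shear F) = 0` for `|e| ∈ {8, 9}`, `e_{a′} + 2|e| + 2|e|_inert < 23`;
* `coeff_shear_div_eq_zero_of_legality` — the same on the residual factor `G = F / x^r` after `peel`;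
* **`coeff_eq_zero_of_degree_eight`** — GROUPS (4,5), (3,4): every degree-`8` monomial of `F` of inert degree `≤ 1`
  is absent («`in₅ g = 0`», «`ord C₁ ≥ 5`»);
* **`rowNine_frobenius`** — GROUP (4,6): the degree-`9` inert-free row of `F` is `x^r (x_{a′}⁵ − t⁵x_a⁵)(λx_a + μx_{a′})`
  (`…FrobeniusShear` rigidity after peeling), together with the sheared residual row `x_{a′}⁵((λ + μt)x_a + μx_{a′})`.
[cite: CossartJannsenSaito2020, Lemma 13.2, Thm. 13.7] [cite: Hauser2010, §I (definition of P⁺)]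
bears_on: LADDER-RESOLUTION:D157-DOOR2 (res-dim4-pi · K2(p) = `RidgeBudget.NoAboveFloorTrap p p` · slice C, lossy residual,
D∞ tilt-free).  Supports stmt-ResolutionOfSingularities-16155 (helper).
-/

set_option linter.dupNamespace false -- mandated namespace of this single-conjunct summit

noncomputable section

namespace Summit.ResolutionOfSingularities.ResolutionOfSingularities.Theorems.PIDim4

namespace ResCone

open MvPolynomial Finset
open Literature.AlgebraicGeometry.Resolution
open Literature.AlgebraicGeometry.Resolution.CentreBlowup
open Literature.AlgebraicGeometry.Resolution.Hauser2010

variable {K : Type} [Field K]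

section Legality

/-- **LEGALITY TRANSPORT** (idea-4 E2 §D: «σ″ > 1 after the re-entry», i.e. `j > 4n − 2D`, read on the SHEARED
parent): let `F₁` be the pure-shear child of `F` in the chart `a` at the point `t·e_{a′}` and `F₂` the pure-corner child
of `F₁` in the chart `a′`, both MODULO NOISE on the `5`-th-power lattice (coefficient laws `hS1`, `hS2` off
`IsPthPowerExponent 5`), with `ord F₁ ≥ 6` and the TILT-FREE LOWER WINDOW at `F₂` (`ord ≥ 7`, the degree-`7`
monomials have `x_a`-exponent `2`).  Then a monomial `x^e` of degree `8` or `9` of the sheared parent with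
`e_{a′} + 2|e| + 2|e|_inert < 23` is ABSENT. [OURS] [cite: CossartJannsenSaito2020, Lemma 13.2, Thm. 13.7] -/
theorem coeff_shear_eq_zero_of_legality {a a' : Fin 4} (haa : a ≠ a') {t : K}
    {F F₁ F₂ : MvPolynomial (Fin 4) K}
    (hS1 : ∀ e : Fin 4 →₀ ℕ, 5 ≤ e.degree → ¬ IsPthPowerExponent 5 (chartExponent 5 Finset.univ a e) →
      coeff (chartExponent 5 Finset.univ a e) F₁ = coeff e (shear a (Pi.single a' t) F))
    (hF₁ : ∀ e' ∈ F₁.support, 6 ≤ e'.degree)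
    (hS2 : ∀ e' : Fin 4 →₀ ℕ, 5 ≤ e'.degree → ¬ IsPthPowerExponent 5 (chartExponent 5 Finset.univ a' e') →
      coeff (chartExponent 5 Finset.univ a' e') F₂ = coeff e' F₁)
    (hF₂ : ∀ E ∈ F₂.support, 7 ≤ E.degree ∧ (E.degree = 7 → E a = 2))
    {e : Fin 4 →₀ ℕ} (hdeg : e.degree = 8 ∨ e.degree = 9)
    (hlt : e a' + 2 * e.degree + 2 * degIn ((Finset.univ.erase a).erase a') e < 23) :
    coeff e (shear a (Pi.single a' t) F) = 0 := by
  by_contra hne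
  have h5e : 5 ≤ e.degree := by omega
  set e' := chartExponent 5 Finset.univ a e with he'
  have he'a : e' a = e.degree - 5 := chartExponent_univ_apply_self 5 a e
  have he'a' : e' a' = e a' := chartExponent_apply_of_ne 5 Finset.univ haa.symm e
  have hnp1 : ¬ IsPthPowerExponent 5 e' :=
    not_isPthPowerExponent_of_not_dvd (i := a) (by rw [he'a]; omega)
  have hc1 : coeff e' F₁ ≠ 0 := by rw [hS1 e h5e hnp1]; exact hne
  have hmem1 : e' ∈ F₁.support := MvPolynomial.mem_support_iff.mpr hc1
  have hdeg1 : e'.degree + 5 + e a = 2 * e.degree := degree_chartExponent_univ 5 a h5e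
  have h6e' : 6 ≤ e'.degree := hF₁ e' hmem1
  have h5e' : 5 ≤ e'.degree := by omega
  set E := chartExponent 5 Finset.univ a' e' with hE
  have hEa : E a = e' a := chartExponent_apply_of_ne 5 Finset.univ haa e'
  have hnp2 : ¬ IsPthPowerExponent 5 E :=
    not_isPthPowerExponent_of_not_dvd (i := a) (by rw [hEa, he'a]; omega)
  have hc2 : coeff E F₂ ≠ 0 := by rw [hS2 e' h5e' hnp2]; exact hc1
  obtain ⟨h7, h7eq⟩ := hF₂ E (MvPolynomial.mem_support_iff.mpr hc2)
  have hdeg2 : E.degree + 5 + e' a' = 2 * e'.degree := degree_chartExponent_univ 5 a' h5e'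
  have hsplit := degree_eq_apply_add_apply_add_degIn haa e
  have hE8 : 8 ≤ E.degree := by
    by_contra hlt8
    have h7' : E.degree = 7 := by omega
    have := h7eq h7'
    rw [hEa, he'a] at this
    omega
  rw [he'a'] at hdeg2
  omega

/-- **LEGALITY ON THE RESIDUAL FACTOR** (after peeling the unit `x_a^α (x_{a′} + t x_a)^β`, `α + β = 3`,
`t ≠ 0`): with `G := F / x^{α e_a + β e_{a′}}`, a monomial `x^e` of degree `5` or `6` of `shear a (t e_{a′}) G` with
`e_{a′} + 2|e| + 2|e|_inert < 17` is ABSENT (idea-4's «realised `j ≥ 4n − 2D + 1`» on the groups `(n, D) =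
(4, 5), (3, 4), (4, 6)`). [OURS] [cite: CossartJannsenSaito2020, Lemma 13.2, Thm. 13.7] -/
theorem coeff_shear_div_eq_zero_of_legality {a a' : Fin 4} (haa : a ≠ a') {α β : ℕ} (hαβ : α + β = 3)
    {t : K} (ht : t ≠ 0) {F F₁ F₂ : MvPolynomial (Fin 4) K}
    (hr : ∀ m ∈ F.support, Finsupp.single a α + Finsupp.single a' β ≤ m)
    (hS1 : ∀ e : Fin 4 →₀ ℕ, 5 ≤ e.degree → ¬ IsPthPowerExponent 5 (chartExponent 5 Finset.univ a e) →
      coeff (chartExponent 5 Finset.univ a e) F₁ = coeff e (shear a (Pi.single a' t) F))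
    (hF₁ : ∀ e' ∈ F₁.support, 6 ≤ e'.degree)
    (hS2 : ∀ e' : Fin 4 →₀ ℕ, 5 ≤ e'.degree → ¬ IsPthPowerExponent 5 (chartExponent 5 Finset.univ a' e') →
      coeff (chartExponent 5 Finset.univ a' e') F₂ = coeff e' F₁)
    (hF₂ : ∀ E ∈ F₂.support, 7 ≤ E.degree ∧ (E.degree = 7 → E a = 2))
    {e : Fin 4 →₀ ℕ} (hdeg : e.degree = 5 ∨ e.degree = 6)
    (hlt : e a' + 2 * e.degree + 2 * degIn ((Finset.univ.erase a).erase a') e < 17) :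
    coeff e (shear a (Pi.single a' t) (F.divMonomial (Finsupp.single a α + Finsupp.single a' β))) = 0 := by
  set P := (Finset.univ.erase a).erase a' with hP
  set G := F.divMonomial (Finsupp.single a α + Finsupp.single a' β) with hG
  have hFG : shear a (Pi.single a' t) F = (∑ l ∈ Finset.range (β + 1),
      monomial (Finsupp.single a (α + l) + Finsupp.single a' (β - l)) (((β.choose l : ℕ) : K) * t ^ l)) *
      shear a (Pi.single a' t) G := by
    conv_lhs => rw [eq_monomial_mul_divMonomial hr]
    rw [shear_mul, shear_monomial_pair haa]
  refine peel haa ht α β (shear a (Pi.single a' t) G) (e a + e a') (fun i => e i)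
    (17 - 2 * e.degree - 2 * degIn P e) ?_ e rfl (fun i _ _ => rfl) (by omega)
  intro e₁ hD hκ hN
  rw [← hFG]
  have hκeq : degIn P e₁ = degIn P e := Finset.sum_congr rfl fun i hi => by
    have hia' : i ≠ a' := Finset.ne_of_mem_erase hi
    have hia : i ≠ a := Finset.ne_of_mem_erase (Finset.mem_of_mem_erase hi)
    exact hκ i hia hia'
  have hdeg₁ : e₁.degree = e.degree := by
    rw [degree_eq_apply_add_apply_add_degIn haa e₁, degree_eq_apply_add_apply_add_degIn haa e, ← hP, hκeq, hD]
  apply coeff_shear_eq_zero_of_legality haa hS1 hF₁ hS2 hF₂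
  · rw [map_add, Finsupp.degree_single, hdeg₁, hαβ]; omega
  · rw [Finsupp.add_apply, Finsupp.single_eq_of_ne haa.symm, add_zero, map_add, Finsupp.degree_single,
      degIn_add, ← hP, degIn_single_of_not_mem (not_mem_passive_left a a'), add_zero, hκeq, hdeg₁, hαβ]
    omega

end Legality

section RowsOfF

/-- The inert degree of an exponent is that of its inert part, which is the latter's total degree. [folklore] -/
theorem degIn_passive_erase {a a' : Fin 4} (haa : a ≠ a') (e : Fin 4 →₀ ℕ) :
    degIn ((Finset.univ.erase a).erase a') ((e.erase a).erase a') = degIn ((Finset.univ.erase a).erase a') e ∧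
    ((e.erase a).erase a').degree = degIn ((Finset.univ.erase a).erase a') e := by
  have h1 : degIn ((Finset.univ.erase a).erase a') ((e.erase a).erase a') =
      degIn ((Finset.univ.erase a).erase a') e := Finset.sum_congr rfl fun i hi => by
    have hia' : i ≠ a' := Finset.ne_of_mem_erase hi
    have hia : i ≠ a := Finset.ne_of_mem_erase (Finset.mem_of_mem_erase hi)
    rw [Finsupp.erase_ne hia', Finsupp.erase_ne hia]
  refine ⟨h1, ?_⟩
  rw [degree_eq_apply_add_apply_add_degIn haa, h1, Finsupp.erase_ne haa, Finsupp.erase_same,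
    Finsupp.erase_same, zero_add, zero_add]

/-- The boundary monomial `x_a^α x_{a′}^β` has no inert part. [folklore] -/
theorem degIn_passive_pair (a a' : Fin 4) (α β : ℕ) :
    degIn ((Finset.univ.erase a).erase a') (Finsupp.single a α + Finsupp.single a' β) = 0 := by
  rw [degIn_add, degIn_single_of_not_mem (not_mem_passive_left a a'),
    degIn_single_of_not_mem (not_mem_passive_right a a')]

/-- **(D1), GROUPS (4,5) AND (3,4): THE DEGREE-`8` ROWS OF THE PARENT VANISH.**  In the setting of
`coeff_shear_div_eq_zero_of_legality` (lose-both step `a`, `t ≠ 0`, weights `α e_a + β e_{a′}`, `α + β = 3`, then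
the pure corner `a′`; noise on the `5`-th-power lattice free; `ord F₁ ≥ 6`; tilt-free lower window at `F₂`):
every monomial of `F` of degree `8` with inert degree `≤ 1` is ABSENT — idea-4's «`in₅ g = 0`» and «`ord C₁ ≥ 5`»
at a lose-both time. [OURS] [cite: CossartJannsenSaito2020, Lemma 13.2, Thm. 13.7] -/
theorem coeff_eq_zero_of_degree_eight {a a' : Fin 4} (haa : a ≠ a') {α β : ℕ} (hαβ : α + β = 3)
    {t : K} (ht : t ≠ 0) {F F₁ F₂ : MvPolynomial (Fin 4) K}
    (hr : ∀ m ∈ F.support, Finsupp.single a α + Finsupp.single a' β ≤ m)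
    (hS1 : ∀ e : Fin 4 →₀ ℕ, 5 ≤ e.degree → ¬ IsPthPowerExponent 5 (chartExponent 5 Finset.univ a e) →
      coeff (chartExponent 5 Finset.univ a e) F₁ = coeff e (shear a (Pi.single a' t) F))
    (hF₁ : ∀ e' ∈ F₁.support, 6 ≤ e'.degree)
    (hS2 : ∀ e' : Fin 4 →₀ ℕ, 5 ≤ e'.degree → ¬ IsPthPowerExponent 5 (chartExponent 5 Finset.univ a' e') →
      coeff (chartExponent 5 Finset.univ a' e') F₂ = coeff e' F₁)
    (hF₂ : ∀ E ∈ F₂.support, 7 ≤ E.degree ∧ (E.degree = 7 → E a = 2))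
    {m : Fin 4 →₀ ℕ} (hm : m.degree = 8) (hκ : degIn ((Finset.univ.erase a).erase a') m ≤ 1) :
    coeff m F = 0 := by
  set P := (Finset.univ.erase a).erase a' with hP
  set r : Fin 4 →₀ ℕ := Finsupp.single a α + Finsupp.single a' β with hrdef
  set G := F.divMonomial r with hG
  by_contra hne
  have hrm : r ≤ m := hr m (MvPolynomial.mem_support_iff.mpr hne)
  set e := m - r with hedef
  have hme : m = r + e := (add_tsub_cancel_of_le hrm).symm
  have hGe : coeff e G = coeff m F := by rw [hG, coeff_divMonomial_pair, ← hme]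
  have hrdeg : r.degree = 3 := by rw [hrdef, map_add, Finsupp.degree_single, Finsupp.degree_single, hαβ]
  have hedeg : e.degree = 5 := by
    have := congrArg Finsupp.degree hme
    rw [map_add, hm, hrdeg] at this
    omega
  have hκe : degIn P e = degIn P m := by
    rw [hme, degIn_add, hP, degIn_passive_pair, zero_add]
  set μ₀ := (e.erase a).erase a' with hμ₀
  have hμa : μ₀ a = 0 := by rw [hμ₀, Finsupp.erase_ne haa, Finsupp.erase_same]
  have hμa' : μ₀ a' = 0 := by rw [hμ₀, Finsupp.erase_same]
  obtain ⟨hμP, hμdeg⟩ := degIn_passive_erase haa e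
  have hsplit := degree_eq_apply_add_apply_add_degIn haa e
  -- the whole row of `e` is killed by legality, hence so is `e`'s coefficient in `G`
  have hsum : e a + e a' + degIn P e = 5 := by rw [← hsplit]; exact hedeg
  have hκ1 : degIn P e ≤ 1 := by rw [hκe]; exact hκ
  have hrow := row_coeff_eq_zero_of_shear haa t G (e a + e a') hμa hμa' (fun j hj => by
    apply coeff_shear_div_eq_zero_of_legality haa hαβ ht hr hS1 hF₁ hS2 hF₂
    · left
      rw [map_add, map_add, Finsupp.degree_single, Finsupp.degree_single, hμdeg]
      omega
    · rw [rowExp_add_apply haa hμa hμa', if_neg haa.symm, if_pos rfl, map_add, map_add, Finsupp.degree_single,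
        Finsupp.degree_single, degIn_add, degIn_passive_pair, zero_add, hμP, hμdeg]
      omega)
  have he : e = Finsupp.single a (e a + e a' - e a') + Finsupp.single a' (e a') + μ₀ := by
    ext i
    rw [rowExp_add_apply haa hμa hμa' (e a + e a') (e a') i]
    by_cases hia : i = a
    · rw [if_pos hia, hia]; omega
    · rw [if_neg hia]
      by_cases hia' : i = a'
      · rw [if_pos hia', hia']
      · rw [if_neg hia', hμ₀, Finsupp.erase_ne hia', Finsupp.erase_ne hia]
  have := hrow (e a') (by omega)
  rw [← he, hGe] at this
  exact hne this

end RowsOfF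

section RowNine

/-- **(D1), GROUP (4,6): THE DEGREE-`9` INERT-FREE ROW OF THE PARENT IS A FROBENIUS ROW** `x^r (x_{a′}⁵ − t⁵ x_a⁵)
(λ x_a + μ x_{a′})` — legality makes the sheared residual row `x_{a′}`-adically of order `≥ 5`, and
`…FrobeniusShear.row_eq_frobeniusRow_of_shear_order_ge` is rigid.  Returned in two readings: the row coefficients of
`F`, and the coefficients of the sheared residual factor on the row (`(λ + μ t)` at `x_a x_{a′}⁵`, `μ` at `x_{a′}⁶`,
nothing else). [OURS] [cite: Hauser2010, §I (definition of P⁺)] [cite: CossartJannsenSaito2020, Thm. 13.7] -/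
theorem rowNine_frobenius {a a' : Fin 4} (haa : a ≠ a') {α β : ℕ} (hαβ : α + β = 3)
    {t : K} (ht : t ≠ 0) [CharP K 5] {F F₁ F₂ : MvPolynomial (Fin 4) K}
    (hr : ∀ m ∈ F.support, Finsupp.single a α + Finsupp.single a' β ≤ m)
    (hS1 : ∀ e : Fin 4 →₀ ℕ, 5 ≤ e.degree → ¬ IsPthPowerExponent 5 (chartExponent 5 Finset.univ a e) →
      coeff (chartExponent 5 Finset.univ a e) F₁ = coeff e (shear a (Pi.single a' t) F))
    (hF₁ : ∀ e' ∈ F₁.support, 6 ≤ e'.degree)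
    (hS2 : ∀ e' : Fin 4 →₀ ℕ, 5 ≤ e'.degree → ¬ IsPthPowerExponent 5 (chartExponent 5 Finset.univ a' e') →
      coeff (chartExponent 5 Finset.univ a' e') F₂ = coeff e' F₁)
    (hF₂ : ∀ E ∈ F₂.support, 7 ≤ E.degree ∧ (E.degree = 7 → E a = 2)) :
    (∀ j, j ≤ 6 →
      coeff (Finsupp.single a α + Finsupp.single a' β + (Finsupp.single a (6 - j) + Finsupp.single a' j)) F =
        (if j = 5 then coeff (Finsupp.single a α + Finsupp.single a' β +
            (Finsupp.single a (6 - 5) + Finsupp.single a' 5)) F else 0) +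
        (if j = 6 then coeff (Finsupp.single a α + Finsupp.single a' β +
            (Finsupp.single a (6 - 6) + Finsupp.single a' 6)) F else 0) -
        ((if j = 0 then t ^ 5 * coeff (Finsupp.single a α + Finsupp.single a' β +
            (Finsupp.single a (6 - 5) + Finsupp.single a' 5)) F else 0) +
          (if j = 1 then t ^ 5 * coeff (Finsupp.single a α + Finsupp.single a' β +
            (Finsupp.single a (6 - 6) + Finsupp.single a' 6)) F else 0))) ∧
    (∀ k, k ≤ 6 →
      coeff (Finsupp.single a (6 - k) + Finsupp.single a' k)
          (shear a (Pi.single a' t) (F.divMonomial (Finsupp.single a α + Finsupp.single a' β))) =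
        (if k = 5 then coeff (Finsupp.single a α + Finsupp.single a' β +
            (Finsupp.single a (6 - 5) + Finsupp.single a' 5)) F +
          coeff (Finsupp.single a α + Finsupp.single a' β +
            (Finsupp.single a (6 - 6) + Finsupp.single a' 6)) F * t else 0) +
        (if k = 6 then coeff (Finsupp.single a α + Finsupp.single a' β +
            (Finsupp.single a (6 - 6) + Finsupp.single a' 6)) F else 0)) := by
  haveI : Fact (Nat.Prime 5) := ⟨by norm_num⟩
  set P := (Finset.univ.erase a).erase a' with hP
  set r : Fin 4 →₀ ℕ := Finsupp.single a α + Finsupp.single a' β with hrdef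
  set G := F.divMonomial r with hG
  set R : MvPolynomial (Fin 4) K := ∑ k ∈ Finset.range (6 + 1),
    monomial (Finsupp.single a (6 - k) + Finsupp.single a' k) (coeff (Finsupp.single a (6 - k) + Finsupp.single a' k) G)
    with hR
  -- the hypotheses of the rigidity lemma at `p = 5`
  have hrow : ∀ d ∈ R.support, ∃ j, j ≤ 5 + 1 ∧ d = Finsupp.single a (5 + 1 - j) + Finsupp.single a' j :=
    fun d hd => by
      obtain ⟨j, hj, rfl⟩ := exists_of_mem_support_rowSum G 6 hd
      exact ⟨j, hj, rfl⟩
  have hlegal : ∀ j, j < 5 →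
      coeff (Finsupp.single a (6 - j) + Finsupp.single a' j) (shear a (Pi.single a' t) G) = 0 := by
    intro j hj5
    apply coeff_shear_div_eq_zero_of_legality haa hαβ ht hr hS1 hF₁ hS2 hF₂
    · right
      rw [map_add, Finsupp.degree_single, Finsupp.degree_single]; omega
    · rw [rowExp_apply haa, if_neg haa.symm, if_pos rfl, map_add, Finsupp.degree_single, Finsupp.degree_single,
        degIn_passive_pair]
      omega
  have hord : ∀ j, j < 5 →
      coeff (Finsupp.single a (5 + 1 - j) + Finsupp.single a' j) (shear a (Pi.single a' t) R) = 0 := by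
    intro j hj5
    have h1 := coeff_shear_rowSum haa t G 6 (j := j) (by omega)
    rw [hlegal j hj5] at h1
    exact h1
  have hRG : ∀ k, k ≤ 6 → coeff (Finsupp.single a (6 - k) + Finsupp.single a' k) R =
      coeff (r + (Finsupp.single a (6 - k) + Finsupp.single a' k)) F := fun k hk => by
    rw [hR, coeff_rowSum haa G 6 hk, hG, coeff_divMonomial_pair]
  refine ⟨fun j hj => ?_, fun k hk => ?_⟩
  · have h : coeff (Finsupp.single a (6 - j) + Finsupp.single a' j) R =
        (if j = 5 then coeff (Finsupp.single a (6 - 5) + Finsupp.single a' 5) R else 0) +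
        (if j = 6 then coeff (Finsupp.single a (6 - 6) + Finsupp.single a' 6) R else 0) -
        ((if j = 0 then t ^ 5 * coeff (Finsupp.single a (6 - 5) + Finsupp.single a' 5) R else 0) +
          (if j = 1 then t ^ 5 * coeff (Finsupp.single a (6 - 6) + Finsupp.single a' 6) R else 0)) :=
      coeff_row_of_shear_order_ge (p := 5) haa t hrow hord j
    rw [hRG j hj, hRG 5 (by norm_num), hRG 6 le_rfl] at h
    exact h
  · -- the sheared row: `shear R = x_{a′}⁵((λ + μ t) x_a + μ x_{a′})`
    have hReq : R = ((X a' : MvPolynomial (Fin 4) K) ^ 5 - C (t ^ 5) * X a ^ 5) *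
        (C (coeff (Finsupp.single a (5 + 1 - 5) + Finsupp.single a' 5) R) * X a +
          C (coeff (Finsupp.single a (5 + 1 - (5 + 1)) + Finsupp.single a' (5 + 1)) R) * X a') :=
      row_eq_frobeniusRow_of_shear_order_ge (p := 5) haa t hrow hord
    have hsh : shear a (Pi.single a' t) R =
        monomial (Finsupp.single a' 5 + Finsupp.single a 1)
          (coeff (Finsupp.single a (6 - 5) + Finsupp.single a' 5) R +
            coeff (Finsupp.single a (6 - 6) + Finsupp.single a' 6) R * t) +
        monomial (Finsupp.single a' 5 + Finsupp.single a' 1)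
          (coeff (Finsupp.single a (6 - 6) + Finsupp.single a' 6) R) := by
      conv_lhs => rw [hReq]
      exact shear_frobeniusRow (p := 5) haa t _ _
    have hk5 : (Finsupp.single a' 5 + Finsupp.single a 1 : Fin 4 →₀ ℕ) =
        Finsupp.single a (6 - 5) + Finsupp.single a' 5 := by rw [add_comm]
    have hk6 : (Finsupp.single a' 5 + Finsupp.single a' 1 : Fin 4 →₀ ℕ) =
        Finsupp.single a (6 - 6) + Finsupp.single a' 6 := by
      rw [← Finsupp.single_add, Nat.sub_self, Finsupp.single_zero, zero_add]
    rw [← coeff_shear_rowSum haa t G 6 hk, ← hR, hsh, coeff_add, coeff_monomial, coeff_monomial, hk5, hk6,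
      ite_rowExp haa, ite_rowExp haa, hRG 5 (by norm_num), hRG 6 le_rfl]

end RowNine

end ResCone

end Summit.ResolutionOfSingularities.ResolutionOfSingularities.Theorems.PIDim4

end
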